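import Literature.Computability.MetaComplexity.OrderingResLinTreeLike
import Literature.Computability.MetaComplexity.ResolutionStepLists
import Literature.Computability.MetaComplexity.ResLinProofs
import HarnessLib

/-!
# Stålmarck's polynomial-size resolution refutation of the ordering principle (Jukna 2012, Thm 18.6)

`Ordering_n` (`orderingCNF n`, `OrderingPrinciple.lean`; Krishnamurthy's / Stålmarck's `GT_n` plus
totality clauses) has RESOLUTION refutations with `O(n³)` lines [Stålmarck 1996; Jukna 2012,
Thm 18.6]: with `S_m(i) = ⋁_{j < m, j ≠ i} x_{ji}` ("`i` has a predecessor below `m`";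
`S_n(i) = NM_i` is an axiom), the clauses `S_m(i)`, `i < m`, are obtained from `S_{m+1}(i)`,
`S_{m+1}(m)`, the transitivity axioms `¬x_{jm} ∨ ¬x_{mi} ∨ x_{ji}` and the anti-symmetry axiom
`¬x_{im} ∨ ¬x_{mi}` for `m = n − 1, …, 1`, and `S_1(0)` is the empty clause.

* `OrderParity.stepList_stalmarckList`: the list of derived clauses (`stalmarckList n`: for each
  `m` and `i < m` the block `T_j = S_m(i) ∨ ¬x_{jm}` (`j < m`), `C_j = S_m(i) ∨ ⋁_{j ≤ j' < m} x_{j'm}`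
  (`j ≤ m`), `S_m(i)`) is a content-addressed step list over the axioms of `Ordering_n`
  (`ResolutionStepLists.lean`).
* `exists_isResRefutation_orderingCNF` / `minResRefutationSize_orderingCNF_le`: for `n ≥ 2`,
  `Ordering_n` has a resolution refutation with at most `8 n³` lines.

Together with `OrderingResLinTreeLike.lean` (every TREE-LIKE Res(⊕) refutation of `Ordering_n` has
`≥ 2^{n−1}` lines) this is the separation of resolution from tree-like Res(⊕) noted in
[Gryaznov–Ovcharov–Riazanov 2024, §1] (`orderingCNF_separation`).

## References

* G. Stålmarck, *Short resolution proofs for a sequence of tricky formulas*, Acta Informatica 33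
  (1996) 277–280 [Stalmarck1996].
* S. Jukna, *Boolean Function Complexity*, Springer 2012, §18.4, Theorem 18.6 (and Fig. 18.4)
  [Jukna2012].
* S. Gryaznov, S. Ovcharov, A. Riazanov, ACM ToCT 16(3) (2024), §1 ("the ordering principle gives a
  natural separation of resolution and tree-like Res(⊕)") [GryaznovOvcharovRiazanov2024].
-/

namespace Literature.Computability.MetaComplexity

open _root_.Computability Complexity Finset

/-! ### The clauses of the refutation -/

/-- `S_m(i) = ⋁_{j < m, j ≠ i} x_{ji}`: "`i` has a predecessor among the first `m` elements"
(`S_n(i) = NM_i`). [Jukna 2012, Thm 18.6 (proof: the clauses `C_m(j)`)] [cite: Jukna2012, Theorem 18.6] -/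
def predClause (n m i : ℕ) : Finset (Literal ℕ) :=
  ((Finset.range m).filter fun j => j ≠ i).image fun j => (ordVar n j i, true)

/-- `T_j = S_m(i) ∨ ¬x_{jm}` (`j < m`): "if `j ≺ m` then `i` has a predecessor below `m`" — the
resolvent of `S_{m+1}(i)` with the transitivity axiom `¬x_{jm} ∨ ¬x_{mi} ∨ x_{ji}` (`j ≠ i`) or the
anti-symmetry axiom `¬x_{im} ∨ ¬x_{mi}` (`j = i`) on `x_{mi}`. [Jukna 2012, Thm 18.6 (Fig. 18.4,
upper part)] [cite: Jukna2012, Theorem 18.6] -/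
def elimClause (n m i j : ℕ) : Finset (Literal ℕ) :=
  insert (ordVar n j m, false) (predClause n m i)

/-- `C_j = S_m(i) ∨ ⋁_{j ≤ j' < m} x_{j'm}` (`j ≤ m`): `S_{m+1}(m) ∨ S_m(i)` with the first `j`
disjuncts resolved away against `T_0, …, T_{j−1}`; `C_m = S_m(i)`. [Jukna 2012, Thm 18.6 (Fig. 18.4,
lower part)] [cite: Jukna2012, Theorem 18.6] -/
def chainClause (n m i j : ℕ) : Finset (Literal ℕ) :=
  (((Finset.range m).filter fun j' => j ≤ j').image fun j' => (ordVar n j' m, true)) ∪ predClause n m i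

/-- The block deriving `S_m(i)`: `T_0, …, T_{m−1}, C_0, …, C_m, S_m(i)`. [Jukna 2012, Thm 18.6
(Fig. 18.4)] [cite: Jukna2012, Theorem 18.6] -/
def stalBlock (n m i : ℕ) : List (Finset (Literal ℕ)) :=
  (List.range m).map (elimClause n m i) ++
    ((List.range (m + 1)).map (chainClause n m i) ++ [predClause n m i])

/-- Round `m`: the blocks of all `i < m` (deriving `S_m(0), …, S_m(m−1)` from the `S_{m+1}`'s).
[Jukna 2012, Thm 18.6 ("For each `m`, clauses `C_m(1), …, C_m(m)` are obtained in parallel")]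
[cite: Jukna2012, Theorem 18.6] -/
def stalRound (n m : ℕ) : List (Finset (Literal ℕ)) :=
  (List.range m).flatMap (stalBlock n m)

/-- **Stålmarck's refutation** as a list of clauses: rounds `m = n − 1, n − 2, …, 1`; the last
clause `S_1(0)` is empty. [Stålmarck 1996; Jukna 2012, Thm 18.6] [cite: Jukna2012, Theorem 18.6] -/
def stalmarckList (n : ℕ) : List (Finset (Literal ℕ)) :=
  (List.range (n - 1)).flatMap fun k => stalRound n (n - 1 - k)

/-! ### Membership lemmas -/

/-- Membership in `S_m(i)`. [folklore] -/
theorem mem_predClause {n m i : ℕ} {l : Literal ℕ} :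
    l ∈ predClause n m i ↔ ∃ j, j < m ∧ j ≠ i ∧ l = (ordVar n j i, true) := by
  unfold predClause
  simp only [Finset.mem_image, Finset.mem_filter, Finset.mem_range]
  constructor
  · rintro ⟨j, ⟨hj, hji⟩, rfl⟩; exact ⟨j, hj, hji, rfl⟩
  · rintro ⟨j, hj, hji, rfl⟩; exact ⟨j, ⟨hj, hji⟩, rfl⟩

/-- Membership in `C_j`. [folklore] -/
theorem mem_chainClause {n m i j : ℕ} {l : Literal ℕ} :
    l ∈ chainClause n m i j ↔
      (∃ j', j' < m ∧ j ≤ j' ∧ l = (ordVar n j' m, true)) ∨ l ∈ predClause n m i := by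
  unfold chainClause
  rw [Finset.mem_union]
  simp only [Finset.mem_image, Finset.mem_filter, Finset.mem_range]
  constructor
  · rintro (⟨j', ⟨hj', hjj'⟩, rfl⟩ | h)
    · exact Or.inl ⟨j', hj', hjj', rfl⟩
    · exact Or.inr h
  · rintro (⟨j', hj', hjj', rfl⟩ | h)
    · exact Or.inl ⟨j', ⟨hj', hjj'⟩, rfl⟩
    · exact Or.inr h

/-- `ordVar n · i` is injective (for `n > 0`). [folklore] -/
theorem ordVar_left_inj {n j j' i : ℕ} (hn : 0 < n) (h : ordVar n j i = ordVar n j' i) : j = j' := by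
  unfold ordVar at h
  exact Nat.eq_of_mul_eq_mul_right hn (by omega)

/-- `S_1(0)` is the empty clause. [Jukna 2012, Thm 18.6 ("At the end we easily derive the empty
clause")] [cite: Jukna2012, Theorem 18.6] -/
theorem predClause_one_zero (n : ℕ) : predClause n 1 0 = ∅ := by
  ext l
  rw [mem_predClause]
  simp only [Finset.notMem_empty, iff_false, not_exists, not_and]
  intro j hj hj0
  omega

/-- `S_n(i)` is the non-minimality axiom `NM_i`. [Jukna 2012, Thm 18.6 ("`C_n(j)`")]
[cite: Jukna2012, Theorem 18.6] -/
theorem toFinset_nonMinClause (n i : ℕ) : (nonMinClause n i).toFinset = predClause n n i := by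
  ext l
  rw [List.mem_toFinset, mem_predClause]
  simp only [nonMinClause, List.mem_map, List.mem_filter, List.mem_range, decide_eq_true_eq]
  constructor
  · rintro ⟨j, ⟨hj, hji⟩, rfl⟩; exact ⟨j, hj, hji, rfl⟩
  · rintro ⟨j, hj, hji, rfl⟩; exact ⟨j, ⟨hj, hji⟩, rfl⟩

/-! ### The axioms used -/

/-- The non-minimality axiom `S_n(i)` is available. [Jukna 2012, Thm 18.6] [cite: Jukna2012, Theorem 18.6] -/
theorem predClause_mem_clauseSet {n i : ℕ} (hi : i < n) :
    predClause n n i ∈ clauseSet (orderingCNF n) :=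
  mem_clauseSet_iff.2 ⟨nonMinClause n i, nonMinClause_mem_orderingCNF hi, toFinset_nonMinClause n i⟩

/-- The transitivity axiom `¬x_{jm} ∨ ¬x_{mi} ∨ x_{ji}` is available. [Jukna 2012, Thm 18.6
("`A(i, j, k)`")] [cite: Jukna2012, Theorem 18.6] -/
theorem transAx_mem_clauseSet {n j m i : ℕ} (hj : j < n) (hm : m < n) (hi : i < n) (hjm : j ≠ m)
    (hji : j ≠ i) (hmi : m ≠ i) :
    ([(ordVar n j m, false), (ordVar n m i, false), (ordVar n j i, true)] : Clause ℕ).toFinset ∈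
      clauseSet (orderingCNF n) :=
  mem_clauseSet_iff.2 ⟨_, mem_orderingCNF_of_mem_linOrderClauses
    (mem_linOrderClauses_iff.2 (Or.inr ⟨j, m, i, hj, hm, hi, hjm, hji, hmi, rfl⟩)), rfl⟩

/-- The anti-symmetry axiom `¬x_{im} ∨ ¬x_{mi}` is available. [Jukna 2012, Thm 18.6 ("`B(i, j)`")]
[cite: Jukna2012, Theorem 18.6] -/
theorem antiAx_mem_clauseSet {n i m : ℕ} (hi : i < n) (hm : m < n) (him : i ≠ m) :
    ([(ordVar n i m, false), (ordVar n m i, false)] : Clause ℕ).toFinset ∈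
      clauseSet (orderingCNF n) :=
  mem_clauseSet_iff.2 ⟨_, mem_orderingCNF_of_mem_linOrderClauses
    (mem_linOrderClauses_iff.2 (Or.inl ⟨i, m, hi, hm, him, Or.inl rfl⟩)), rfl⟩

/-! ### The steps -/

section Steps

variable {n m i : ℕ} {A : Set (Finset (Literal ℕ))}

/-- **Step `T_j`**: from `S_{m+1}(i) ∋ x_{mi}` and the transitivity (resp. anti-symmetry) axiom
`∋ ¬x_{mi}`, resolve on `x_{mi}`. [Jukna 2012, Thm 18.6 (Fig. 18.4)] [cite: Jukna2012, Theorem 18.6] -/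
theorem derivStep_elimClause (hax : clauseSet (orderingCNF n) ⊆ A)
    (hS : predClause n (m + 1) i ∈ A) (hi : i < m) (hmn : m < n) {j : ℕ} (hj : j < m) :
    DerivStep A (elimClause n m i j) := by
  have hD : (ordVar n m i, true) ∈ predClause n (m + 1) i :=
    mem_predClause.2 ⟨m, Nat.lt_succ_self m, by omega, rfl⟩
  -- the part of `S_{m+1}(i)` other than `x_{mi}` is `S_m(i)`
  have hDsub : (predClause n (m + 1) i).erase (ordVar n m i, true) ⊆ elimClause n m i j := by
    intro y hy
    obtain ⟨hne, hy⟩ := Finset.mem_erase.1 hy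
    obtain ⟨j', hj', hj'i, rfl⟩ := mem_predClause.1 hy
    have hj'm : j' ≠ m := fun h => hne (by rw [h])
    unfold elimClause
    exact Finset.mem_insert_of_mem (mem_predClause.2 ⟨j', by omega, hj'i, rfl⟩)
  have hself : (ordVar n j m, false) ∈ elimClause n m i j := by
    unfold elimClause; exact Finset.mem_insert_self _ _
  have hpred : predClause n m i ⊆ elimClause n m i j := by
    unfold elimClause; exact Finset.subset_insert _ _
  by_cases hji : j = i
  · -- anti-symmetry axiom `¬x_{im} ∨ ¬x_{mi}`
    have hE := hax (antiAx_mem_clauseSet (n := n) (i := j) (m := m) (by omega) hmn (by omega))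
    refine DerivStep.of_res hS hE hD ?_ hDsub ?_
    · rw [List.mem_toFinset, hji]; simp
    · intro y hy
      obtain ⟨hne, hy⟩ := Finset.mem_erase.1 hy
      rw [List.mem_toFinset] at hy
      simp only [List.mem_cons, List.not_mem_nil, or_false] at hy
      rcases hy with rfl | rfl
      · exact hself
      · rw [hji] at hne; exact absurd rfl hne
  · -- transitivity axiom `¬x_{jm} ∨ ¬x_{mi} ∨ x_{ji}`
    have hE := hax (transAx_mem_clauseSet (n := n) (j := j) (m := m) (i := i) (by omega) hmn
      (by omega) (by omega) hji (by omega))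
    refine DerivStep.of_res hS hE hD ?_ hDsub ?_
    · rw [List.mem_toFinset]; simp
    · intro y hy
      obtain ⟨hne, hy⟩ := Finset.mem_erase.1 hy
      rw [List.mem_toFinset] at hy
      simp only [List.mem_cons, List.not_mem_nil, or_false] at hy
      rcases hy with rfl | rfl | rfl
      · exact hself
      · exact absurd rfl hne
      · exact hpred (mem_predClause.2 ⟨j, hj, hji, rfl⟩)

/-- **Step `C_0`**: a weakening of `S_{m+1}(m)`. [Jukna 2012, Thm 18.6 (Fig. 18.4)]
[cite: Jukna2012, Theorem 18.6] -/
theorem derivStep_chainClause_zero (hSm : predClause n (m + 1) m ∈ A) :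
    DerivStep A (chainClause n m i 0) := by
  refine DerivStep.of_mem hSm fun y hy => ?_
  obtain ⟨j', hj', hj'm, rfl⟩ := mem_predClause.1 hy
  exact mem_chainClause.2 (Or.inl ⟨j', by omega, Nat.zero_le _, rfl⟩)

/-- **Step `C_{j+1}`**: resolve `C_j ∋ x_{jm}` with `T_j ∋ ¬x_{jm}` on `x_{jm}`. [Jukna 2012,
Thm 18.6 (Fig. 18.4)] [cite: Jukna2012, Theorem 18.6] -/
theorem derivStep_chainClause_succ {j : ℕ} (hC : chainClause n m i j ∈ A)
    (hT : elimClause n m i j ∈ A) (hj : j < m) :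
    DerivStep A (chainClause n m i (j + 1)) := by
  refine DerivStep.of_res hC hT (mem_chainClause.2 (Or.inl ⟨j, hj, le_rfl, rfl⟩))
    (by unfold elimClause; exact Finset.mem_insert_self _ _) ?_ ?_
  · intro y hy
    obtain ⟨hne, hy⟩ := Finset.mem_erase.1 hy
    rcases mem_chainClause.1 hy with ⟨j', hj', hjj', rfl⟩ | hy
    · have hj'j : j' ≠ j := fun h => hne (by rw [h])
      exact mem_chainClause.2 (Or.inl ⟨j', hj', by omega, rfl⟩)
    · exact mem_chainClause.2 (Or.inr hy)
  · intro y hy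
    obtain ⟨hne, hy⟩ := Finset.mem_erase.1 hy
    unfold elimClause at hy
    rcases Finset.mem_insert.1 hy with rfl | hy
    · exact absurd rfl hne
    · exact mem_chainClause.2 (Or.inr hy)

/-- **Last step of the block**: `C_m` is (a weakening of nothing but) `S_m(i)`. [Jukna 2012,
Thm 18.6 (Fig. 18.4)] [cite: Jukna2012, Theorem 18.6] -/
theorem derivStep_predClause (hC : chainClause n m i m ∈ A) : DerivStep A (predClause n m i) := by
  refine DerivStep.of_mem hC fun y hy => ?_
  rcases mem_chainClause.1 hy with ⟨j', hj', hjj', rfl⟩ | hy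
  · omega
  · exact hy

/-- **The block of `S_m(i)` is a step list** over any set of clauses containing the axioms and the
clauses `S_{m+1}(i')`, `i' ≤ m`. [Jukna 2012, Thm 18.6 (Fig. 18.4)] [cite: Jukna2012, Theorem 18.6] -/
theorem stepList_stalBlock (hax : clauseSet (orderingCNF n) ⊆ A)
    (hS : ∀ i' ≤ m, predClause n (m + 1) i' ∈ A) (hi : i < m) (hmn : m < n) :
    StepList A (stalBlock n m i) := by
  unfold stalBlock
  refine StepList.append (stepList_map_range fun j hj =>
    (derivStep_elimClause hax (hS i hi.le) hi hmn hj).mono Set.subset_union_left) ?_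
  refine StepList.append (stepList_map_range fun j hj => ?_) ?_
  · rcases j with _ | j
    · exact (derivStep_chainClause_zero (hS m le_rfl)).mono fun D hD =>
        Or.inl (Or.inl hD)
    · have hjm : j < m := by omega
      refine derivStep_chainClause_succ ?_ ?_ hjm
      · exact Or.inr ⟨j, Nat.lt_succ_self j, rfl⟩
      · exact Or.inl (Or.inr (List.mem_map.2 ⟨j, List.mem_range.2 hjm, rfl⟩))
  · refine stepList_singleton (derivStep_predClause ?_)
    exact Or.inr (List.mem_map.2 ⟨m, List.mem_range.2 (Nat.lt_succ_self m), rfl⟩)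

/-- **Round `m` is a step list.** [Jukna 2012, Thm 18.6] [cite: Jukna2012, Theorem 18.6] -/
theorem stepList_stalRound (hax : clauseSet (orderingCNF n) ⊆ A)
    (hS : ∀ i' ≤ m, predClause n (m + 1) i' ∈ A) (hmn : m < n) : StepList A (stalRound n m) := by
  unfold stalRound
  exact stepList_flatMap_range fun i hi =>
    (stepList_stalBlock hax hS hi hmn).mono Set.subset_union_left

/-- Round `m` contains `S_m(i)` for every `i < m`. [Jukna 2012, Thm 18.6] [cite: Jukna2012, Theorem 18.6] -/
theorem predClause_mem_stalRound {i : ℕ} (hi : i < m) : predClause n m i ∈ stalRound n m := by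
  unfold stalRound stalBlock
  rw [List.mem_flatMap]
  exact ⟨i, List.mem_range.2 hi, List.mem_append_right _ (List.mem_append_right _
    (List.mem_singleton_self _))⟩

end Steps

/-! ### The refutation -/

/-- **Stålmarck's list is a step list over the axioms of `Ordering_n`.** [Stålmarck 1996; Jukna
2012, Thm 18.6] [cite: Jukna2012, Theorem 18.6] -/
theorem stepList_stalmarckList (n : ℕ) : StepList (clauseSet (orderingCNF n)) (stalmarckList n) := by
  unfold stalmarckList
  refine stepList_flatMap_range fun k hk => ?_
  refine stepList_stalRound Set.subset_union_left (fun i' hi' => ?_) (by omega)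
  rcases k with _ | k
  · -- round `n − 1`: the `S_n(i')` are axioms
    have h : n - 1 - 0 + 1 = n := by omega
    rw [h]
    exact Or.inl (predClause_mem_clauseSet (by omega))
  · -- later rounds: `S_{m+1}(i')` was derived in the previous round
    have h : n - 1 - (k + 1) + 1 = n - 1 - k := by omega
    rw [h]
    exact Or.inr ⟨k, Nat.lt_succ_self k, predClause_mem_stalRound (by omega)⟩

/-- The empty clause `S_1(0)` belongs to Stålmarck's list (`n ≥ 2`). [Jukna 2012, Thm 18.6]
[cite: Jukna2012, Theorem 18.6] -/
theorem empty_mem_stalmarckList {n : ℕ} (hn : 2 ≤ n) : (∅ : Finset (Literal ℕ)) ∈ stalmarckList n := by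
  rw [← predClause_one_zero n]
  unfold stalmarckList
  rw [List.mem_flatMap]
  refine ⟨n - 2, List.mem_range.2 (by omega), ?_⟩
  have h : n - 1 - (n - 2) = 1 := by omega
  rw [h]
  exact predClause_mem_stalRound Nat.zero_lt_one

/-- The length of Stålmarck's list is at most `2 n³`. [Jukna 2012, Thm 18.6 ("polynomial size")]
[cite: Jukna2012, Theorem 18.6] -/
theorem length_stalmarckList_le (n : ℕ) : (stalmarckList n).length ≤ 2 * n ^ 3 := by
  have hblock : ∀ m i, (stalBlock n m i).length = 2 * m + 2 := by
    intro m i; simp [stalBlock]; omega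
  have hround : ∀ m, (stalRound n m).length = m * (2 * m + 2) := by
    intro m
    unfold stalRound
    rw [List.length_flatMap]
    simp only [hblock, List.map_const', List.sum_replicate, List.length_range, smul_eq_mul]
  unfold stalmarckList
  rw [List.length_flatMap]
  have hle : ∀ k ∈ List.range (n - 1), ((fun k => stalRound n (n - 1 - k)) k).length ≤ 2 * n ^ 2 := by
    intro k hk
    have hk' := List.mem_range.1 hk
    simp only [hround]
    have h1 : n - 1 - k ≤ n := by omega
    calc (n - 1 - k) * (2 * (n - 1 - k) + 2) ≤ n * (2 * n) :=
          Nat.mul_le_mul h1 (by omega)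
      _ = 2 * n ^ 2 := by ring
  calc ((List.range (n - 1)).map fun k => ((fun k => stalRound n (n - 1 - k)) k).length).sum
      ≤ ((List.range (n - 1)).map fun _ => 2 * n ^ 2).sum :=
        List.sum_le_sum fun k hk => hle k hk
    _ = (n - 1) * (2 * n ^ 2) := by simp
    _ ≤ 2 * n ^ 3 := by
        have : (n - 1) * (2 * n ^ 2) ≤ n * (2 * n ^ 2) := Nat.mul_le_mul_right _ (Nat.sub_le n 1)
        calc (n - 1) * (2 * n ^ 2) ≤ n * (2 * n ^ 2) := this
          _ = 2 * n ^ 3 := by ring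

/-- **Stålmarck's theorem for `Ordering_n`** [Stålmarck 1996; Jukna 2012, Thm 18.6 ("The CNF formula
`GT_n` has a regular resolution refutation of polynomial size")]: for `n ≥ 2`, `Ordering_n` has a
resolution refutation with at most `8 n³` lines. (Regularity is not tracked here.)
[cite: Jukna2012, Theorem 18.6] -/
theorem exists_isResRefutation_orderingCNF {n : ℕ} (hn : 2 ≤ n) :
    ∃ π : List (ResLine ℕ), IsResRefutation (orderingCNF n) π ∧ π.length ≤ 8 * n ^ 3 := by
  obtain ⟨π, hπ, hlen, hall⟩ := (stepList_stalmarckList n).exists_isResDerivation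
  obtain ⟨l, hl, hl0⟩ := hall ∅ (empty_mem_stalmarckList hn)
  refine ⟨π, ⟨hπ, l, hl, hl0⟩, ?_⟩
  have := length_stalmarckList_le n
  omega

/-- Stålmarck's bound in `ℕ∞` form: `S_R(Ordering_n) ≤ 8 n³` (`n ≥ 2`). [Stålmarck 1996; Jukna 2012,
Thm 18.6] [cite: Jukna2012, Theorem 18.6] -/
theorem minResRefutationSize_orderingCNF_le {n : ℕ} (hn : 2 ≤ n) :
    minResRefutationSize (orderingCNF n) ≤ ((8 * n ^ 3 : ℕ) : ℕ∞) := by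
  obtain ⟨π, hπ, hlen⟩ := exists_isResRefutation_orderingCNF hn
  calc minResRefutationSize (orderingCNF n) ≤ π.length := minResRefutationSize_le_length hπ
    _ ≤ ((8 * n ^ 3 : ℕ) : ℕ∞) := by exact_mod_cast hlen

/-! ### The separation of resolution from tree-like Res(⊕) -/

/-- **`Ordering_n` separates (dag-like) resolution from tree-like Res(⊕)** [Gryaznov–Ovcharov–
Riazanov 2024, §1 ("the ordering principle gives a natural separation of resolution and tree-like
Res(⊕)"); Stålmarck 1996; GOR 2024 Thm 4]: for `n ≥ 2`, `Ordering_n` has a resolution refutation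
with `≤ 8n³` lines and a (dag-like) Res(⊕) refutation with `≤ 8n³ + |Ordering_n|` lines, while every
TREE-LIKE Res(⊕) refutation has `≥ 2^{n−1}` lines (`OrderingResLinTreeLike.lean`).
[cite: GryaznovOvcharovRiazanov2024, §1] -/
theorem orderingCNF_separation {n : ℕ} (hn : 2 ≤ n) :
    (∃ π : List (ResLine ℕ), IsResRefutation (orderingCNF n) π ∧ π.length ≤ 8 * n ^ 3) ∧
      (∃ π : List ResLinLine, IsResLinRefutation (orderingCNF n) π ∧
        π.length ≤ 8 * n ^ 3 + (orderingCNF n).length) ∧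
      ∀ π : List ResLinLine, IsResLinRefutation (orderingCNF n) π →
        (∀ i : ℕ, (π.map fun l => l.premises.count i).sum ≤ 1) → 2 ^ (n - 1) ≤ π.length := by
  obtain ⟨π, hπ, hlen⟩ := exists_isResRefutation_orderingCNF hn
  obtain ⟨π', hπ', hlen'⟩ := exists_isResLinRefutation_of_isResRefutation_holds hπ
  exact ⟨⟨π, hπ, hlen⟩, ⟨π', hπ', by omega⟩,
    fun π hπ htree => two_pow_le_length_orderingCNF_treeLike hπ htree⟩

end Literature.Computability.MetaComplexity
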